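import Summits.NavierStokesRegularity.NavierStokesRegularity.Theorems.TypeICertificateLadderTargetWeightedGapLemmaSlice
import Literature.Analysis.FluidPDE.PineauVicolRSSAlphaZero
import HarnessLib

/-!
# Crux `Target` (stmt-NavierStokesRegularity-1217), line `killing-twisted-bernoulli-solitons`:
  STUB B4, the weighted gap lemma (`stub_weightedGapLemma`)

For Type-I rotated self-similar (RSS) Navier–Stokes solutions (Pineau–Vicol, arXiv:2607.09619),
`u = pvAnsatz α U` on `[−1, 0)`, classical with a pressure, `‖u(t,x)‖ ≤ C₀/(‖x‖ + √(−t))`,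
profile `U = u(−1, ·)`, and a positive conjugate density `m` with the Gaussian lower bound
`c e^{−7|y|²/16} ≤ m` (and upper bound `m ≤ M₁ e^{−|y|²/16}`), there is a threshold
`ε₀ = ε₀(C₀, c, M₁) > 0` such that `∫ ‖curl U‖² m ≤ ε₀` forces `U ≡ 0`.

Proof (Pineau–Vicol, proof of Thm. 1.4 for small `|α|`, Proposition 3.1 with (3.3)–(3.4), the
weight replacing (5.4); here at ONE slice of the Leray profile, so that no period argument is
needed).
1. Backward extension (footnote 21; `exists_isClassicalNSSolutionOn_Iio_of_isRotatedDSS` with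
   `isRotatedDSS_pvAnsatz`) and the rotation-free Leray profile `V = lerayOrbit u`,
   `V(s, y) = R(αs) U(R(−αs) y)` (`lerayOrbit_pvAnsatz`), a classical solution of the backward
   Leray system on `ℝ × ℝ³` (`isClassicalNSSolutionOn_Iio_iff_isBackwardLeraySolutionOn`) with
   `V(0) = U`.
2. The Type-I derivative bounds `‖DᵏV(s, y)‖ ≤ K_k(C₀) max{|y|,1}^{−(k+1)}` (Lemma 7.1 in Leray
   variables, `exists_forall_iteratedFDeriv_lerayOrbit_le`, constants depending on `C₀` only)
   give at `s = 0` the slice-integrability hypotheses (`weightedGap_slice_integrable`) and the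
   far-field smallness `‖DU(y)‖ ≤ ⅛` for `|y| ≥ R̄ := 8K₁ + 1`.
3. Local smallness from weighted smallness: on `B(0, R̄)`, `m ≥ κ := c e^{−7R̄²/16}`, so
   `∫_{B_R̄} ‖curl U‖² ≤ κ⁻¹ ∫ ‖curl U‖² m ≤ κ⁻¹ ε₀ = δ²` for `ε₀ := κ δ²`,
   `δ := 1/(16(C_Ω + 1))` (`C_Ω = vortexConst`, so `C_Ω δ < ⅛`).
4. The gap lemma at the slice `s = 0` (`weightedGap_profile_eq_zero`): the enstrophy identity
   `PineauVicol2026.enstrophy_slice`, whose time term vanishes for a rigidly rotating profile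
   (`weightedGap_timeTerm_eq_zero`: `∫⟪∂ₛΩ, Ω⟫ = −α∫⟪DΩ_U[Jy], Ω_U⟫ = 0`), the stretching
   estimate (3.4) `PineauVicol2026.integral_inner_curl_fderiv_curl_le`, absorption
   (`(⅛ − C_Ωδ)‖Ω‖₂² ≤ 0`), `curl U ≡ 0`, and the Liouville step
   `PineauVicol2026.eq_zero_of_curl_eq_zero_of_isDivFree_of_norm_le` (`div U = 0`,
   `|U| ≤ C₀/(1+|y|)`).

Only positivity and the two Gaussian bounds of `m` are used (the upper bound for the
integrability of `‖curl U‖² m`); normalisation, gradient decay and the kernel equation are not.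
Lands `--supports stmt-NavierStokesRegularity-1217`, registered stub `stub_weightedGapLemma`.
-/

noncomputable section

namespace Summit.NavierStokesRegularity.NavierStokesRegularity.Theorems

open MeasureTheory Set Function Filter Topology InnerProductSpace
open scoped RealInnerProductSpace ContDiff Laplacian ENNReal
open Literature.Analysis Literature.Analysis.FluidPDE Literature.Analysis.FluidPDE.PineauVicol2026

/-! ### The gap lemma on one slice of a rigidly rotating Leray profile -/

/-- **The gap lemma for a rigidly rotating profile (Pineau–Vicol Prop. 3.1, (3.3)–(3.4), run at
the slice `s = 0`).** Let `(V, Q)` solve the backward Leray system on `ℝ × ℝ³` with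
`V(s, y) = R(αs) U(R(−αs) y)` (so `V(0) = U`), and let the profile obey `|U(y)| ≤ C₀/(|y|+1)`
and the Type-I derivative bounds `‖DᵏU(y)‖ ≤ K_k max{|y|,1}^{−(k+1)}`, `k = 1,2,3`. If
`‖DU‖ ≤ ⅛` off `B(0, R)` and the local enstrophy is small, `‖curl U‖_{L²(B_R)} ≤ δ` with
`C_Ω δ < ⅛`, then `U ≡ 0`: the slice identity `PineauVicol2026.enstrophy_slice` at `s = 0` has a
vanishing time term (`weightedGap_timeTerm_eq_zero`), the stretching term is absorbed by
`PineauVicol2026.integral_inner_curl_fderiv_curl_le`, whence `∫|curl U|² = 0`, `curl U ≡ 0`, and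
the Liouville step `PineauVicol2026.eq_zero_of_curl_eq_zero_of_isDivFree_of_norm_le` applies. -/
theorem weightedGap_profile_eq_zero
    {V : ℝ → EuclideanSpace ℝ (Fin 3) → EuclideanSpace ℝ (Fin 3)}
    {Q : ℝ → EuclideanSpace ℝ (Fin 3) → ℝ} (hL : IsBackwardLeraySolutionOn univ 1 V Q)
    {α : ℝ} {U : EuclideanSpace ℝ (Fin 3) → EuclideanSpace ℝ (Fin 3)}
    (hVeq : ∀ s y, V s y = rotZ (α * s) (U (rotZ (-(α * s)) y)))
    {C₀ K₁ K₂ K₃ R δ : ℝ} (hUb : ∀ y, ‖U y‖ ≤ C₀ / (‖y‖ + 1))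
    (h1 : ∀ y, ‖iteratedFDeriv ℝ 1 U y‖ ≤ K₁ * ((max ‖y‖ 1)⁻¹) ^ 2)
    (h2 : ∀ y, ‖iteratedFDeriv ℝ 2 U y‖ ≤ K₂ * ((max ‖y‖ 1)⁻¹) ^ 3)
    (h3 : ∀ y, ‖iteratedFDeriv ℝ 3 U y‖ ≤ K₃ * ((max ‖y‖ 1)⁻¹) ^ 4)
    (hsmall : ∀ y, R ≤ ‖y‖ → ‖fderiv ℝ U y‖ ≤ 1 / 8)
    (hδ : Real.sqrt (∫ y in Metric.ball 0 R, ‖curl U y‖ ^ 2) ≤ δ)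
    (hδC : vortexConst * δ < 1 / 8) : U = 0 := by
  have hV0 : V 0 = U := funext fun z => by rw [hVeq, mul_zero, neg_zero, rotZ_zero, rotZ_zero]
  have hUs : ContDiff ℝ ∞ U := by
    rw [← hV0]; exact hL.smooth_velocity.contDiff_slice (mem_univ 0)
  have hU3 : ContDiff ℝ 3 U := hUs.of_le (by norm_cast)
  have hU2 : ContDiff ℝ 2 U := hUs.of_le (by norm_cast)
  have hdiv : VectorCalculus.IsDivFree U := by
    rw [← hV0]; exact hL.divFree 0 (mem_univ 0)
  have hC₀ : 0 ≤ C₀ := by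
    have h := (norm_nonneg _).trans (hUb 0)
    simpa using h
  have hUC : ∀ y, ‖U y‖ ≤ C₀ := fun y =>
    (hUb y).trans (div_le_self hC₀ (by linarith [norm_nonneg y]))
  have h4 : MemLp U 4 volume := memLp_four_of_profile_bound hUs.continuous hUb
  obtain ⟨hΩ2, hΩD, hDΩ2, hLap⟩ := weightedGap_slice_integrable hU3 h1 h2 h3
  have hΩ2c : ContDiff ℝ 2 (curl U) := contDiff_two_curl hU3
  have hΩc : Continuous (curl U) := hΩ2c.continuous
  have hDΩc : Continuous (fderiv ℝ (curl U)) := (hΩ2c.of_le one_le_two).continuous_fderiv one_ne_zero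
  -- the stretching estimate (3.4) and the Frobenius dissipation
  obtain ⟨hSi, hSle⟩ := integral_inner_curl_fderiv_curl_le hU3 hdiv h4 hΩ2 hDΩ2 hsmall
  have hΩDi : Integrable fun y => ‖curl U y‖ * ‖fderiv ℝ (curl U) y‖ :=
    hΩD.mono' (hΩc.norm.mul hDΩc.norm).aestronglyMeasurable (Eventually.of_forall fun y => by
      rw [Real.norm_eq_abs, abs_of_nonneg (by positivity)]
      have hy : (1 : ℝ) ≤ 1 + ‖y‖ := by linarith [norm_nonneg y]
      nlinarith [mul_nonneg (norm_nonneg (curl U y)) (norm_nonneg (fderiv ℝ (curl U) y))])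
  obtain ⟨hFi, -⟩ := integral_inner_laplacian_self_eq_neg hΩ2c hΩDi hDΩ2 hLap
  have hbOF : ∫ y, ‖fderiv ℝ (curl U) y‖ ^ 2 ≤ ∫ y, frobeniusNormSq (fderiv ℝ (curl U) y) :=
    integral_mono hDΩ2 hFi fun y => norm_sq_le_frobeniusNormSq _
  -- the slice identity at `s = 0`, with vanishing time term
  have e := enstrophy_slice hL 0 (C₀ := C₀) (fun y => by rw [hV0]; exact hUC y)
    (by rw [hV0]; exact hΩ2) (by rw [hV0]; exact hΩD) (by rw [hV0]; exact hDΩ2)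
    (by rw [hV0]; exact hLap) (by rw [hV0]; exact hSi)
  rw [weightedGap_timeTerm_eq_zero hL hVeq hΩ2 hΩD, hV0, zero_add] at e
  -- absorption
  set a : ℝ := ∫ y, ‖curl U y‖ ^ 2 with ha
  set bF : ℝ := ∫ y, frobeniusNormSq (fderiv ℝ (curl U) y) with hbF
  set bO : ℝ := ∫ y, ‖fderiv ℝ (curl U) y‖ ^ 2 with hbO
  have ha0 : 0 ≤ a := integral_nonneg fun y => sq_nonneg _
  have hbO0 : 0 ≤ bO := integral_nonneg fun y => sq_nonneg _
  have hδ0 : 0 ≤ δ := (Real.sqrt_nonneg _).trans hδ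
  have hC := vortexConst_nonneg
  have hSt : ∫ y, ⟪curl U y, fderiv ℝ U y (curl U y)⟫ ≤ (1 / 8) * a + vortexConst * δ * (a + bO) := by
    refine hSle.trans ?_
    have h := mul_le_mul_of_nonneg_left hδ hC
    nlinarith [mul_nonneg hC (Real.sqrt_nonneg (∫ y in Metric.ball 0 R, ‖curl U y‖ ^ 2))]
  have hale : a ≤ 0 := by
    nlinarith [mul_nonneg (mul_nonneg hC hδ0) (sub_nonneg.2 hbOF), mul_nonneg (mul_nonneg hC hδ0) hbO0]
  -- hence `curl U ≡ 0`
  have ha_eq : a = 0 := le_antisymm hale ha0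
  have hae : (fun y => ‖curl U y‖ ^ 2) =ᵐ[volume] 0 :=
    (integral_eq_zero_iff_of_nonneg (fun y => sq_nonneg _) hΩ2).1 ha_eq
  have hzero : (fun y => ‖curl U y‖ ^ 2) = 0 :=
    (Continuous.ae_eq_iff_eq volume (hΩc.norm.pow 2) continuous_const).1 hae
  have hcurl : ∀ y, curl U y = 0 := fun y => by
    have h := congr_fun hzero y
    simpa using h
  exact eq_zero_of_curl_eq_zero_of_isDivFree_of_norm_le hU2 hcurl hdiv fun y => by
    rw [add_comm]; exact hUb y

/-! ### Stub B4 -/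

/-- **Stub B4: the weighted gap threshold `ε₀(C₀, c, M₁)` below which a Type-I RSS profile with a
conjugate density is trivial.** For every `C₀ > 0`, `c > 0`, `M₁ > 0` there is `ε₀ > 0` such
that: if `(u, p)` is a classical Navier–Stokes solution on `[−1, 0)` with the Type-I bound
`‖u(t,x)‖ ≤ C₀/(‖x‖ + √(−t))`, rotated self-similar with a `C²` profile `U` and speed `α`
(`u = pvAnsatz α U`), and `m` is a positive `C²` density with `c e^{−7|y|²/16} ≤ m ≤ M₁ e^{−|y|²/16}`
(normalised, with Gaussian gradient decay, in the kernel of the rotating adjoint operator — these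
three clauses are not used), then `∫ ‖curl U‖² m ≤ ε₀` forces `U ≡ 0`.
Proof: extend `u` backwards to `(−∞, 0)` (`exists_isClassicalNSSolutionOn_Iio_of_isRotatedDSS`),
pass to the rotation-free Leray profile `V = lerayOrbit u`, `V(s) = R(αs) U R(−αs)`
(`lerayOrbit_pvAnsatz`), which solves the backward Leray system; the Type-I derivative bounds
`‖DᵏV(s)‖ ≤ K_k(C₀) max{|y|,1}^{−(k+1)}` (`exists_forall_iteratedFDeriv_lerayOrbit_le`) give at
`s = 0` the slice hypotheses and `‖DU‖ ≤ ⅛` off `B(0, R̄)`, `R̄ = 8K₁ + 1`; the weight's lower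
bound turns `∫‖curl U‖² m ≤ ε₀ := c e^{−7R̄²/16} δ²`, `δ = 1/(16(C_Ω + 1))`, into
`‖curl U‖_{L²(B_R̄)} ≤ δ`; conclude by `weightedGap_profile_eq_zero`.
[cite: PineauVicol2026, Proposition 3.1 and §5 (arXiv:2607.09619 pp. 10–13)] -/
theorem stub_weightedGapLemma :
    ∀ C₀ : ℝ, 0 < C₀ → ∀ c M₁ : ℝ, 0 < c → 0 < M₁ → ∃ ε₀ : ℝ, 0 < ε₀ ∧ ∀ (α : ℝ) (u : ℝ → EuclideanSpace ℝ (Fin 3) → EuclideanSpace ℝ (Fin 3)) (p : ℝ → EuclideanSpace ℝ (Fin 3) → ℝ) (U : EuclideanSpace ℝ (Fin 3) → EuclideanSpace ℝ (Fin 3)) (m : EuclideanSpace ℝ (Fin 3) → ℝ), Literature.Analysis.FluidPDE.IsClassicalNSSolutionOn (Set.Ico (-1) 0) 1 0 u p → (∀ t ∈ Set.Ico (-1 : ℝ) 0, ∀ x : EuclideanSpace ℝ (Fin 3), ‖u t x‖ ≤ C₀ / (‖x‖ + Real.sqrt (-t))) → ContDiff ℝ 2 U → (∀ t ∈ Set.Ico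 (-1 : ℝ) 0, ∀ x : EuclideanSpace ℝ (Fin 3), u t x = Literature.Analysis.FluidPDE.pvAnsatz α (fun y _ => U y) t x) → (ContDiff ℝ 2 m ∧ (∀ y, 0 < m y) ∧ (∫ y, m y = 1) ∧ (∀ y, c * Real.exp (-(7 / 16 : ℝ) * ‖y‖ ^ 2) ≤ m y) ∧ (∀ y, m y ≤ M₁ * Real.exp (-(1 / 16 : ℝ) * ‖y‖ ^ 2)) ∧ (∃ M₂ : ℝ, ∀ y, ‖fderiv ℝ m y‖ ≤ M₂ * Real.exp (-(1 / 32 : ℝ) * ‖y‖ ^ 2)) ∧ (∀ y, Laplacian.laplacian m y + Literature.Analysis.FluidPDE.VectorCalculus.divergence (fun z => m z • (U z + (1 / 2 : ℝ) • z - α • Literature.Analysis.FluidPDE.rotGen z)) y = 0)) → (∫ y, ‖Literature.Analysis.FluidPDE.curl U y‖ ^ 2 * m y ≤ ε₀) → U = 0 := by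
  intro C₀ _hC₀ c M₁ hc hM₁
  -- the Type-I derivative constants `K_k(C₀)` of Lemma 7.1 in Leray variables
  obtain ⟨K₁, hK₁0, hK₁⟩ := exists_forall_iteratedFDeriv_lerayOrbit_le 1 C₀
  obtain ⟨K₂, -, hK₂⟩ := exists_forall_iteratedFDeriv_lerayOrbit_le 2 C₀
  obtain ⟨K₃, -, hK₃⟩ := exists_forall_iteratedFDeriv_lerayOrbit_le 3 C₀
  -- the thresholds
  set R : ℝ := 8 * K₁ + 1 with hR
  have hR0 : 0 < R := by rw [hR]; positivity
  have hR1 : 1 ≤ R := by rw [hR]; linarith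
  set δ : ℝ := 1 / (16 * (vortexConst + 1)) with hδ
  have hCΩ := vortexConst_nonneg
  have hδ0 : 0 < δ := by rw [hδ]; positivity
  have hδC : vortexConst * δ < 1 / 8 := by
    rw [hδ, mul_one_div, div_lt_div_iff₀ (by positivity) (by norm_num)]
    nlinarith
  set κ : ℝ := c * Real.exp (-(7 / 16 : ℝ) * R ^ 2) with hκ
  have hκ0 : 0 < κ := by rw [hκ]; positivity
  refine ⟨κ * δ ^ 2, by positivity, ?_⟩
  intro α u p U m hsol hI _hU hans hm hε
  obtain ⟨hmC2, hmpos, -, hmlow, hmup, -, -⟩ := hm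
  -- backward extension to `(−∞, 0)` with the same Type-I constant, and the Leray profile
  obtain ⟨P, hP⟩ := exists_isClassicalNSSolutionOn_Iio_of_isRotatedDSS hsol one_lt_two
    (isRotatedDSS_pvAnsatz (α := α) (U := fun y _ => U y) two_pos fun _ _ => rfl) hans
  have hUb : ∀ y, ‖U y‖ ≤ C₀ / (‖y‖ + 1) := profile_bound_of_typeI hI hans
  have hIw : ∀ t ∈ Iio (0 : ℝ), ∀ x, ‖pvAnsatz α (fun y _ => U y) t x‖ ≤ C₀ / (‖x‖ + Real.sqrt (-t)) :=
    fun t ht x => norm_pvAnsatz_le_of_profile hUb ht x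
  have hL : IsBackwardLeraySolutionOn univ 1 (lerayOrbit (pvAnsatz α fun y _ => U y))
      (lerayOrbitPressure P) :=
    isClassicalNSSolutionOn_Iio_iff_isBackwardLeraySolutionOn.1 hP
  have hVeq : ∀ s y, lerayOrbit (pvAnsatz α fun y _ => U y) s y = rotZ (α * s) (U (rotZ (-(α * s)) y)) :=
    fun s y => lerayOrbit_pvAnsatz α (fun y _ => U y) s y
  have hV0 : lerayOrbit (pvAnsatz α fun y _ => U y) 0 = U :=
    funext fun z => by rw [hVeq, mul_zero, neg_zero, rotZ_zero, rotZ_zero]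
  -- the derivative bounds at `s = 0`
  have h1 : ∀ y, ‖iteratedFDeriv ℝ 1 U y‖ ≤ K₁ * ((max ‖y‖ 1)⁻¹) ^ 2 := fun y => by
    have h := hK₁ _ P hP hIw 0 y; rwa [hV0] at h
  have h2 : ∀ y, ‖iteratedFDeriv ℝ 2 U y‖ ≤ K₂ * ((max ‖y‖ 1)⁻¹) ^ 3 := fun y => by
    have h := hK₂ _ P hP hIw 0 y; rwa [hV0] at h
  have h3 : ∀ y, ‖iteratedFDeriv ℝ 3 U y‖ ≤ K₃ * ((max ‖y‖ 1)⁻¹) ^ 4 := fun y => by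
    have h := hK₃ _ P hP hIw 0 y; rwa [hV0] at h
  -- far field: `‖DU‖ ≤ 1/8` for `|y| ≥ R = 8K₁ + 1`
  have hsmall : ∀ y, R ≤ ‖y‖ → ‖fderiv ℝ U y‖ ≤ 1 / 8 := by
    intro y hy
    have hy1 : 1 ≤ ‖y‖ := hR1.trans hy
    have hy0 : 0 < ‖y‖ := one_pos.trans_le hy1
    have hmax : max ‖y‖ 1 = ‖y‖ := max_eq_left hy1
    have hρ : (max ‖y‖ 1)⁻¹ ≤ R⁻¹ := by rw [hmax]; exact inv_anti₀ hR0 hy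
    have hρ1 : (max ‖y‖ 1)⁻¹ ≤ 1 := by rw [hmax]; exact inv_le_one_of_one_le₀ hy1
    have hρ0 : 0 ≤ (max ‖y‖ 1)⁻¹ := by rw [hmax]; exact inv_nonneg.2 hy0.le
    calc ‖fderiv ℝ U y‖ = ‖iteratedFDeriv ℝ 1 U y‖ := (norm_iteratedFDeriv_one U).symm
      _ ≤ K₁ * ((max ‖y‖ 1)⁻¹) ^ 2 := h1 y
      _ ≤ K₁ * R⁻¹ := by
          refine mul_le_mul_of_nonneg_left ?_ hK₁0
          calc ((max ‖y‖ 1)⁻¹) ^ 2 = (max ‖y‖ 1)⁻¹ * (max ‖y‖ 1)⁻¹ := sq _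
            _ ≤ R⁻¹ * 1 := mul_le_mul hρ hρ1 hρ0 (inv_nonneg.2 hR0.le)
            _ = R⁻¹ := mul_one _
      _ ≤ 1 / 8 := by
          rw [← div_eq_mul_inv, div_le_div_iff₀ hR0 (by norm_num), hR]
          nlinarith
  -- local smallness from the weight's Gaussian lower bound
  obtain ⟨hΩ2, -, -, -⟩ := weightedGap_slice_integrable
    ((hV0 ▸ hL.smooth_velocity.contDiff_slice (mem_univ 0)).of_le (by norm_cast)) h1 h2 h3
  have hΩc : Continuous fun y => ‖curl U y‖ ^ 2 :=
    (contDiff_two_curl ((hV0 ▸ hL.smooth_velocity.contDiff_slice (mem_univ 0)).of_le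
      (by norm_cast))).continuous.norm.pow 2
  have hmR : ∀ y ∈ Metric.ball (0 : EuclideanSpace ℝ (Fin 3)) R, κ ≤ m y := by
    intro y hy
    rw [Metric.mem_ball, dist_zero_right] at hy
    refine le_trans ?_ (hmlow y)
    refine mul_le_mul_of_nonneg_left (Real.exp_le_exp.2 ?_) hc.le
    have : ‖y‖ ^ 2 ≤ R ^ 2 := pow_le_pow_left₀ (norm_nonneg _) hy.le 2
    nlinarith
  have hprod : Integrable fun y => ‖curl U y‖ ^ 2 * m y := by
    refine (hΩ2.const_mul M₁).mono' (hΩc.mul hmC2.continuous).aestronglyMeasurable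
      (Eventually.of_forall fun y => ?_)
    rw [Real.norm_of_nonneg (mul_nonneg (sq_nonneg _) (hmpos y).le)]
    have hmy : m y ≤ M₁ := (hmup y).trans
      (mul_le_of_le_one_right hM₁.le (Real.exp_le_one_iff.2 (by nlinarith [sq_nonneg ‖y‖])))
    calc ‖curl U y‖ ^ 2 * m y ≤ ‖curl U y‖ ^ 2 * M₁ := mul_le_mul_of_nonneg_left hmy (sq_nonneg _)
      _ = M₁ * ‖curl U y‖ ^ 2 := mul_comm _ _
  have hball : ∫ y in Metric.ball 0 R, ‖curl U y‖ ^ 2 ≤ δ ^ 2 := by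
    calc ∫ y in Metric.ball 0 R, ‖curl U y‖ ^ 2
        ≤ ∫ y in Metric.ball 0 R, κ⁻¹ * (‖curl U y‖ ^ 2 * m y) := by
          refine setIntegral_mono_on hΩ2.integrableOn (hprod.const_mul κ⁻¹).integrableOn
            measurableSet_ball fun y hy => ?_
          have h1' : 1 ≤ κ⁻¹ * m y := by
            rw [le_inv_mul_iff₀ hκ0, mul_one]; exact hmR y hy
          calc ‖curl U y‖ ^ 2 = ‖curl U y‖ ^ 2 * 1 := (mul_one _).symm
            _ ≤ ‖curl U y‖ ^ 2 * (κ⁻¹ * m y) := mul_le_mul_of_nonneg_left h1' (sq_nonneg _)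
            _ = κ⁻¹ * (‖curl U y‖ ^ 2 * m y) := by ring
      _ = κ⁻¹ * ∫ y in Metric.ball 0 R, ‖curl U y‖ ^ 2 * m y := integral_const_mul _ _
      _ ≤ κ⁻¹ * ∫ y, ‖curl U y‖ ^ 2 * m y :=
          mul_le_mul_of_nonneg_left (setIntegral_le_integral hprod
            (Eventually.of_forall fun y => mul_nonneg (sq_nonneg _) (hmpos y).le)) (inv_nonneg.2 hκ0.le)
      _ ≤ κ⁻¹ * (κ * δ ^ 2) := mul_le_mul_of_nonneg_left hε (inv_nonneg.2 hκ0.le)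
      _ = δ ^ 2 := by rw [← mul_assoc, inv_mul_cancel₀ hκ0.ne', one_mul]
  have hδle : Real.sqrt (∫ y in Metric.ball 0 R, ‖curl U y‖ ^ 2) ≤ δ :=
    (Real.sqrt_le_sqrt hball).trans_eq (Real.sqrt_sq hδ0.le)
  exact weightedGap_profile_eq_zero hL hVeq hUb h1 h2 h3 hsmall hδle hδC

end Summit.NavierStokesRegularity.NavierStokesRegularity.Theorems

end
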